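import Summits.AtomisticToContinuum.FouriersLaw.Theses.PhononMeanFreePath

/-!
# Sketch — crux ideas for `IncoherentChannel` (stmt-AtomisticToContinuum-11811), ideator 3, round 1

First lemmas of the three idea cards, stated over existing declarations
(`pinnedChain`, `OscillatorChain.transitionKernel`, `OscillatorChain.gibbsMeasure`, `partialP`,
the route decl `Theses.PhononMeanFreePath.IncoherentChannel`).  Nothing here is a skeleton (no stubs are
registered); but the two compositions that conclude the crux BY NAME are PROVED sorry-free:
`incoherentChannel_of_depolarisedConductance` (card `replica-depolarisation`: the transfer is lossless) and
`incoherentChannel_of_window'` (card `depolarised-wake-positivity`: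
WakePositivityEventually → DiffusiveAbelWindow → WakeTransitTime → IncoherentChannel, via the
abstract positive-Tauberian exchange `tendsto_of_abelWindow_of_eventually` plus the integral
bookkeeping `e^{-x} ≤ 1`, `1 - e^{-x} ≤ x`; the pointwise-positivity corollaries
`windowComposition` / `incoherentChannel_of_window` are kept).  Revision 3 (after kit j008777):
the load-bearing sign hypothesis is the EVENTUAL one — the MD refutes pointwise positivity of
the wake for chains of 1–2 bonds (coherent-echo lobe) and supports it from N ≈ 4 on.
-/

noncomputable section

open MeasureTheory Filter Topology Set
open Literature.MathematicalPhysics.KineticTheory.HeatConduction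

namespace Summit.AtomisticToContinuum.FouriersLaw.Cruxes.IncoherentChannel.Ideator3

/-! ## Common objects: the equilibrium kernels of the (N+1)-site chain, both baths at `T` -/

/-- `K_t(z, ·)`: the constructed transition kernel of `pinnedChain ω₂ lam β γ` with `N+1` sites,
both baths at temperature `T`, at time `t` (junk-clamped at `t ≤ 0` through `toNNReal`). -/
def ker (ω₂ lam β γ T : ℝ) (N : ℕ) (t : ℝ) (z : PhaseSpace (N + 1)) : Measure (PhaseSpace (N + 1)) :=
  (pinnedChain ω₂ lam β γ).transitionKernel (N + 1) T T t.toNNReal z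

/-- `μ₀`: the Gibbs measure of the (N+1)-site chain at temperature `T`. -/
def gib (ω₂ lam β γ T : ℝ) (N : ℕ) : Measure (PhaseSpace (N + 1)) :=
  (pinnedChain ω₂ lam β γ).gibbsMeasure (N + 1) T

/-- `r_N(t) = ⟨p_0, K_t p_N⟩_{μ₀}` — the coherent (one-point-response) kernel of the route. -/
def rN (ω₂ lam β γ T : ℝ) (N : ℕ) (t : ℝ) : ℝ :=
  ∫ z, z.2 0 * (∫ y, y.2 (Fin.last N) ∂(ker ω₂ lam β γ T N t z)) ∂(gib ω₂ lam β γ T N)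

/-- `C_N(t) = Cov_{μ₀}(p_0², K_t p_N²)` — the BoundaryKubo kernel of the route. -/
def CN (ω₂ lam β γ T : ℝ) (N : ℕ) (t : ℝ) : ℝ :=
  (∫ z, (z.2 0) ^ 2 * (∫ y, (y.2 (Fin.last N)) ^ 2 ∂(ker ω₂ lam β γ T N t z)) ∂(gib ω₂ lam β γ T N))
    - (∫ z, (z.2 0) ^ 2 ∂(gib ω₂ lam β γ T N))
      * (∫ z, (∫ y, (y.2 (Fin.last N)) ^ 2 ∂(ker ω₂ lam β γ T N t z)) ∂(gib ω₂ lam β γ T N))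

/-- The crux's integrand, the connected fourth cumulant `cum₄(p_0,p_0,p_N(t),p_N(t)) = C_N − 2 r_N²`
("thermal wake" / "depolarised kernel"). -/
def wake (ω₂ lam β γ T : ℝ) (N : ℕ) (t : ℝ) : ℝ :=
  CN ω₂ lam β γ T N t - 2 * (rN ω₂ lam β γ T N t) ^ 2

/-- Read-back: the crux is `N (γ²/T²) ∫₀^∞ wake_N → κ > 0`. -/
theorem incoherentChannel_iff_wake :
    Theses.PhononMeanFreePath.IncoherentChannel ↔
      ∀ ω₂ lam β γ : ℝ, 0 < ω₂ → 0 < lam → 0 < β → 0 < γ → ∀ T : ℝ, 0 < T → ∃ κ : ℝ, 0 < κ ∧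
        Tendsto (fun N : ℕ => (N : ℝ) * (γ ^ 2 / T ^ 2) * ∫ t in Ioi (0 : ℝ), wake ω₂ lam β γ T N t)
          atTop (𝓝 κ) :=
  Iff.rfl

/-! ## Card `replica-depolarisation`: two independent replicas make the cumulant a covariance

`cum₄(t) = ½ Cov_{μ₀⊗μ₀}((p_0 + p_0')², (K_t ⊗ K_t)(p_N − p_N')²)`: the crux's kernel is the
time-lagged covariance between the COMMON-mode kinetic energy of two independent equilibrium
replicas at the near contact and their DIFFERENTIAL-mode kinetic energy at the far contact
("depolarised transmission"); written with iterated integrals only. -/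

/-- The depolarised transfer kernel of the doubled chain (two independent replicas `z, z'`). -/
def depol (ω₂ lam β γ T : ℝ) (N : ℕ) (t : ℝ) : ℝ :=
  (1 / 2) *
    ((∫ z, ∫ z', (z.2 0 + z'.2 0) ^ 2 *
          (∫ y, ∫ y', (y.2 (Fin.last N) - y'.2 (Fin.last N)) ^ 2
              ∂(ker ω₂ lam β γ T N t z') ∂(ker ω₂ lam β γ T N t z))
        ∂(gib ω₂ lam β γ T N) ∂(gib ω₂ lam β γ T N))
      - (∫ z, ∫ z', (z.2 0 + z'.2 0) ^ 2 ∂(gib ω₂ lam β γ T N) ∂(gib ω₂ lam β γ T N))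
        * (∫ z, ∫ z', (∫ y, ∫ y', (y.2 (Fin.last N) - y'.2 (Fin.last N)) ^ 2
              ∂(ker ω₂ lam β γ T N t z') ∂(ker ω₂ lam β γ T N t z))
            ∂(gib ω₂ lam β γ T N) ∂(gib ω₂ lam β γ T N)))

/-- FIRST LEMMA of `replica-depolarisation` (support, theorem-grade at fixed `N`: product
structure of `μ₀ ⊗ μ₀`, Markov kernels, `E_{μ₀} K_t p_N = 0`, Gaussian fourth moments). -/
def ReplicaDepolarisation : Prop :=
  ∀ ω₂ lam β γ : ℝ, 0 < ω₂ → 0 < lam → 0 < β → 0 < γ → ∀ T : ℝ, 0 < T → ∀ (N : ℕ) (t : ℝ), 0 < t →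
    wake ω₂ lam β γ T N t = depol ω₂ lam β γ T N t

/-- TRANSFER form of the crux: the depolarised conductance of the doubled chain carries `κ`. -/
def DepolarisedConductance : Prop :=
  ∀ ω₂ lam β γ : ℝ, 0 < ω₂ → 0 < lam → 0 < β → 0 < γ → ∀ T : ℝ, 0 < T → ∃ κ : ℝ, 0 < κ ∧
    Tendsto (fun N : ℕ => (N : ℝ) * (γ ^ 2 / T ^ 2) * ∫ t in Ioi (0 : ℝ), depol ω₂ lam β γ T N t)
      atTop (𝓝 κ)

/-- The transfer is lossless: given the replica identity the two statements coincide. PROVED. -/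
theorem incoherentChannel_of_depolarisedConductance (hR : ReplicaDepolarisation)
    (hD : DepolarisedConductance) : Theses.PhononMeanFreePath.IncoherentChannel := by
  rw [incoherentChannel_iff_wake]
  intro ω₂ lam β γ hω hl hβ hγ T hT
  obtain ⟨κ, hκ, hlim⟩ := hD ω₂ lam β γ hω hl hβ hγ T hT
  refine ⟨κ, hκ, ?_⟩
  have h : ∀ N : ℕ, (∫ t in Ioi (0 : ℝ), wake ω₂ lam β γ T N t) =
      ∫ t in Ioi (0 : ℝ), depol ω₂ lam β γ T N t := fun N =>
    setIntegral_congr_fun measurableSet_Ioi fun t ht => hR ω₂ lam β γ hω hl hβ hγ T hT N t ht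
  simp_rw [h]
  exact hlim

/-- The common-mode far kernel `K⁺⁺ = C_N + 2 r_N²` (replica-symmetric transmission); with
`depol = K⁺⁻` one has `r_N² = (K⁺⁺ − K⁺⁻)/4`: the coherent channel is the ± asymmetry, and
CoherentDephasing ⟺ replica EQUIPARTITION of the transmitted heat. -/
def commonModeKernel (ω₂ lam β γ T : ℝ) (N : ℕ) (t : ℝ) : ℝ :=
  CN ω₂ lam β γ T N t + 2 * (rN ω₂ lam β γ T N t) ^ 2

/-- Depolarisation ratio of the heat transmitted to the far bath. -/
def depolRatio (ω₂ lam β γ T : ℝ) (N : ℕ) : ℝ :=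
  (∫ t in Ioi (0 : ℝ), wake ω₂ lam β γ T N t) / (∫ t in Ioi (0 : ℝ), commonModeKernel ω₂ lam β γ T N t)

/-- Replica equipartition: the transmitted heat is asymptotically unpolarised. Implied by
CoherentDephasing once `N · G_N` is bounded below; stated as the replica reading of crux A. -/
def ReplicaEquipartition : Prop :=
  ∀ ω₂ lam β γ : ℝ, 0 < ω₂ → 0 < lam → 0 < β → 0 < γ → ∀ T : ℝ, 0 < T →
    Tendsto (fun N : ℕ => depolRatio ω₂ lam β γ T N) atTop (𝓝 1)

/-! ## Card `depolarised-wake-positivity`: a sign for the cumulant kernel and the Tauberian exchange -/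

/-- SUPER-WICK / WAKE POSITIVITY: the kinetic-energy covariance of the two bath momenta dominates
its Wick (Gaussian) part at every time lag. -/
def WakePositivity : Prop :=
  ∀ ω₂ lam β γ : ℝ, 0 < ω₂ → 0 < lam → 0 < β → 0 < γ → ∀ T : ℝ, 0 < T → ∀ (N : ℕ) (t : ℝ), 0 < t →
    0 ≤ wake ω₂ lam β γ T N t

/-- EVENTUAL WAKE POSITIVITY: the sign for all large `N` only — the form the data support
(kit j008777: negative lobe after the first peak for `N ≤ 2` bonds, at the noise floor by `N = 4`)
and all the Tauberian exchange needs. -/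
def WakePositivityEventually : Prop :=
  ∀ ω₂ lam β γ : ℝ, 0 < ω₂ → 0 < lam → 0 < β → 0 < γ → ∀ T : ℝ, 0 < T → ∃ N₀ : ℕ, ∀ N : ℕ, N₀ ≤ N →
    ∀ t : ℝ, 0 < t → 0 ≤ wake ω₂ lam β γ T N t

theorem wakePositivityEventually_of_wakePositivity (h : WakePositivity) : WakePositivityEventually :=
  fun ω₂ lam β γ hω hl hβ hγ T hT => ⟨0, fun N _ t ht => h ω₂ lam β γ hω hl hβ hγ T hT N t ht⟩

/-- Its frozen-medium (short-time) corner: FIRST LEMMA of the card (Jensen on the thermal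
transmission amplitude `∏ V″(r_i(0))`; fixed `N`, small `t`). -/
def ShortTimeWakePositivity : Prop :=
  ∀ ω₂ lam β γ : ℝ, 0 < ω₂ → 0 < lam → 0 < β → 0 < γ → ∀ T : ℝ, 0 < T → ∀ N : ℕ,
    ∃ t₀ : ℝ, 0 < t₀ ∧ ∀ t ∈ Ioo (0 : ℝ) t₀, 0 ≤ wake ω₂ lam β γ T N t

/-- DIFFUSIVE ABEL WINDOW: on the diffusive Laplace diagonal `ν = s/N²` the incoherent channel
converges to `κ φ(s)`, `φ(0⁺) = 1` (the hydrodynamic-window statement in cum₄ clothing). -/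
def DiffusiveAbelWindow : Prop :=
  ∀ ω₂ lam β γ : ℝ, 0 < ω₂ → 0 < lam → 0 < β → 0 < γ → ∀ T : ℝ, 0 < T → ∃ κ : ℝ, 0 < κ ∧
    ∃ φ : ℝ → ℝ, (∀ s, 0 < s → φ s ≤ 1) ∧ Tendsto φ (𝓝[>] 0) (𝓝 1) ∧ ∀ s : ℝ, 0 < s →
      Tendsto (fun N : ℕ => (N : ℝ) * (γ ^ 2 / T ^ 2) *
        ∫ t in Ioi (0 : ℝ), Real.exp (-(s * t / (N : ℝ) ^ 2)) * wake ω₂ lam β γ T N t) atTop (𝓝 (κ * φ s))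

/-- WAKE TRANSIT TIME: the first time-moment of the (nonnegative) wake is at most diffusive,
`(γ²/T²) ∫₀^∞ t · wake_N(t) dt ≤ C · N` (mass `≍ 1/N` arriving at times `≍ N²`). -/
def WakeTransitTime : Prop :=
  ∀ ω₂ lam β γ : ℝ, 0 < ω₂ → 0 < lam → 0 < β → 0 < γ → ∀ T : ℝ, 0 < T → ∃ C : ℝ, ∀ N : ℕ,
    IntegrableOn (fun t => t * wake ω₂ lam β γ T N t) (Ioi 0) ∧
    IntegrableOn (fun t => wake ω₂ lam β γ T N t) (Ioi 0) ∧
      (γ ^ 2 / T ^ 2) * ∫ t in Ioi (0 : ℝ), t * wake ω₂ lam β γ T N t ≤ C * N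

/-- The composition the card proposes for a crux-plan (recorded as a `Prop`; its real-variable
core is `tendsto_of_abelWindow_of_nonneg` below). -/
def WindowComposition : Prop :=
  WakePositivity → DiffusiveAbelWindow → WakeTransitTime → Theses.PhononMeanFreePath.IncoherentChannel

/-- **The Tauberian exchange is done by a SIGN.** Abstract real-variable core, PROVED: if
`a_N(s) → κ φ(s)` for every `s > 0` with `φ(0⁺) = 1`, and `a_N(s) ≤ a_N(0) ≤ a_N(s) + C s`
(the two inequalities that positivity of the wake and the transit-time bound give, via
`e^{-x} ≤ 1` and `1 - e^{-x} ≤ x`), then `a_N(0) → κ`. -/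
theorem tendsto_of_abelWindow_of_nonneg {a : ℕ → ℝ → ℝ} {κ C : ℝ} {φ : ℝ → ℝ}
    (hφ : Tendsto φ (𝓝[>] 0) (𝓝 1))
    (hwin : ∀ s, 0 < s → Tendsto (fun N => a N s) atTop (𝓝 (κ * φ s)))
    (hlow : ∀ s, 0 < s → ∀ N, a N s ≤ a N 0)
    (hup : ∀ s, 0 < s → ∀ N, a N 0 ≤ a N s + C * s) :
    Tendsto (fun N => a N 0) atTop (𝓝 κ) := by
  rw [Metric.tendsto_atTop]
  intro ε hε
  -- choose s with |κ φ(s) - κ| < ε/3 and C s < ε/3 (and s > 0)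
  have hκφ : Tendsto (fun s => κ * φ s) (𝓝[>] 0) (𝓝 κ) := by
    simpa using hφ.const_mul κ
  have h1 : ∀ᶠ s in 𝓝[>] (0 : ℝ), dist (κ * φ s) κ < ε / 3 :=
    (Metric.tendsto_nhds.mp hκφ) (ε / 3) (by positivity)
  have h2 : ∀ᶠ s in 𝓝[>] (0 : ℝ), |C| * s < ε / 3 := by
    have : Tendsto (fun s : ℝ => |C| * s) (𝓝[>] 0) (𝓝 (|C| * 0)) :=
      (tendsto_nhdsWithin_of_tendsto_nhds (continuous_const.mul continuous_id).continuousAt).mono_left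
        le_rfl |>.congr (fun _ => rfl)
    have h0 : |C| * (0 : ℝ) < ε / 3 := by simpa using (by positivity : (0:ℝ) < ε / 3)
    exact this.eventually (gt_mem_nhds (by simpa using h0))
  have h3 : ∀ᶠ s in 𝓝[>] (0 : ℝ), 0 < s := eventually_mem_nhdsWithin
  obtain ⟨s, hs1, hs2, hs3⟩ := (h1.and (h2.and h3)).exists
  obtain ⟨N₀, hN₀⟩ := (Metric.tendsto_atTop.mp (hwin s hs3)) (ε / 3) (by positivity)
  refine ⟨N₀, fun N hN => ?_⟩
  have hA := hN₀ N hN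
  have hl := hlow s hs3 N
  have hu := hup s hs3 N
  rw [Real.dist_eq] at hA hs1 ⊢
  have hCs : C * s ≤ |C| * s := mul_le_mul_of_nonneg_right (le_abs_self C) hs3.le
  rw [abs_lt] at hA hs1 ⊢
  constructor <;> nlinarith [hA.1, hA.2, hs1.1, hs1.2, hCs, hs2]

/-- Eventual version of the exchange lemma: the two one-sided inequalities are only needed for
all large `N` (this is what the MD data of kit job j008777 call for: the wake of very short
chains has a negative lobe, which disappears by `N = 4` bonds at `lam·T = β·T = 1`). PROVED. -/
theorem tendsto_of_abelWindow_of_eventually {a : ℕ → ℝ → ℝ} {κ C : ℝ} {φ : ℝ → ℝ}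
    (hφ : Tendsto φ (𝓝[>] 0) (𝓝 1))
    (hwin : ∀ s, 0 < s → Tendsto (fun N => a N s) atTop (𝓝 (κ * φ s)))
    (hlow : ∀ s, 0 < s → ∀ᶠ N in atTop, a N s ≤ a N 0)
    (hup : ∀ s, 0 < s → ∀ᶠ N in atTop, a N 0 ≤ a N s + C * s) :
    Tendsto (fun N => a N 0) atTop (𝓝 κ) := by
  rw [Metric.tendsto_atTop]
  intro ε hε
  have hκφ : Tendsto (fun s => κ * φ s) (𝓝[>] 0) (𝓝 κ) := by
    simpa using hφ.const_mul κ
  have h1 : ∀ᶠ s in 𝓝[>] (0 : ℝ), dist (κ * φ s) κ < ε / 3 :=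
    (Metric.tendsto_nhds.mp hκφ) (ε / 3) (by positivity)
  have h2 : ∀ᶠ s in 𝓝[>] (0 : ℝ), |C| * s < ε / 3 := by
    have : Tendsto (fun s : ℝ => |C| * s) (𝓝[>] 0) (𝓝 (|C| * 0)) :=
      (tendsto_nhdsWithin_of_tendsto_nhds (continuous_const.mul continuous_id).continuousAt).mono_left
        le_rfl |>.congr (fun _ => rfl)
    have h0 : |C| * (0 : ℝ) < ε / 3 := by simpa using (by positivity : (0:ℝ) < ε / 3)
    exact this.eventually (gt_mem_nhds (by simpa using h0))
  have h3 : ∀ᶠ s in 𝓝[>] (0 : ℝ), 0 < s := eventually_mem_nhdsWithin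
  obtain ⟨s, hs1, hs2, hs3⟩ := (h1.and (h2.and h3)).exists
  have hA : ∀ᶠ N in atTop, dist (a N s) (κ * φ s) < ε / 3 :=
    (Metric.tendsto_nhds.mp (hwin s hs3)) (ε / 3) (by positivity)
  obtain ⟨N₀, hN₀⟩ := eventually_atTop.mp (hA.and ((hlow s hs3).and (hup s hs3)))
  refine ⟨N₀, fun N hN => ?_⟩
  obtain ⟨hA, hl, hu⟩ := hN₀ N hN
  rw [Real.dist_eq] at hA hs1 ⊢
  have hCs : C * s ≤ |C| * s := mul_le_mul_of_nonneg_right (le_abs_self C) hs3.le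
  rw [abs_lt] at hA hs1 ⊢
  constructor <;> nlinarith [hA.1, hA.2, hs1.1, hs1.2, hCs, hs2]


/-- Pointwise bounds used by the composition: `0 ≤ e^{-x} ≤ 1` and `1 - e^{-x} ≤ x` for `x ≥ 0`. -/
theorem exp_neg_le_one_of_nonneg {x : ℝ} (hx : 0 ≤ x) : Real.exp (-x) ≤ 1 := by
  rw [Real.exp_le_one_iff]; linarith

theorem one_sub_exp_neg_le {x : ℝ} : 1 - Real.exp (-x) ≤ x := by
  have := Real.add_one_le_exp (-x); linarith

/-- **The composition of card `depolarised-wake-positivity`, PROVED** (in the EVENTUAL form):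
eventual positivity of the wake, the diffusive Abel window and the transit-time bound imply the
crux (integral bookkeeping + `tendsto_of_abelWindow_of_eventually`). -/
theorem incoherentChannel_of_window' (hWP : WakePositivityEventually) (hW : DiffusiveAbelWindow)
    (hTT : WakeTransitTime) : Theses.PhononMeanFreePath.IncoherentChannel := by
  rw [incoherentChannel_iff_wake]
  intro ω₂ lam β γ hω hl hβ hγ T hT
  obtain ⟨κ, hκ, φ, -, hφ, hwin⟩ := hW ω₂ lam β γ hω hl hβ hγ T hT
  obtain ⟨C, hC⟩ := hTT ω₂ lam β γ hω hl hβ hγ T hT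
  obtain ⟨N₀, hN₀⟩ := hWP ω₂ lam β γ hω hl hβ hγ T hT
  refine ⟨κ, hκ, ?_⟩
  -- abbreviations
  set w : ℕ → ℝ → ℝ := fun N t => wake ω₂ lam β γ T N t with hw
  have hpos : ∀ (N : ℕ), N₀ ≤ N → ∀ (t : ℝ), t ∈ Ioi (0:ℝ) → 0 ≤ w N t := fun N hN t ht =>
    hN₀ N hN t ht
  set g : ℝ := γ ^ 2 / T ^ 2 with hg
  have hg0 : 0 ≤ g := by positivity
  -- the family a N s
  set a : ℕ → ℝ → ℝ := fun N s => (N : ℝ) * g * ∫ t in Ioi (0:ℝ), Real.exp (-(s * t / (N : ℝ) ^ 2)) * w N t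
    with ha
  have ha0 : ∀ N : ℕ, a N 0 = (N : ℝ) * g * ∫ t in Ioi (0:ℝ), w N t := by
    intro N; simp [ha]
  -- integrability facts
  have hIw : ∀ N : ℕ, IntegrableOn (fun t => w N t) (Ioi 0) := fun N => (hC N).2.1
  have hItw : ∀ N : ℕ, IntegrableOn (fun t => t * w N t) (Ioi 0) := fun N => (hC N).1
  have hmeas_exp : ∀ (N : ℕ) (s : ℝ), Continuous fun t : ℝ => Real.exp (-(s * t / (N : ℝ) ^ 2)) := by
    intro N s; fun_prop
  have hIew : ∀ (N : ℕ) (s : ℝ), N₀ ≤ N → 0 ≤ s →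
      IntegrableOn (fun t => Real.exp (-(s * t / (N : ℝ) ^ 2)) * w N t) (Ioi 0) := by
    intro N s hN hs
    refine Integrable.mono' (hIw N) ?_ ?_
    · exact ((hmeas_exp N s).aestronglyMeasurable).mul (hIw N).aestronglyMeasurable
    · filter_upwards [self_mem_ae_restrict (measurableSet_Ioi : MeasurableSet (Ioi (0:ℝ)))] with t ht
      rw [Real.norm_eq_abs, abs_mul, abs_of_nonneg (Real.exp_pos _).le, abs_of_nonneg (hpos N hN t ht)]
      have hx : 0 ≤ s * t / (N : ℝ) ^ 2 := by
        have : 0 ≤ t := le_of_lt ht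
        positivity
      calc Real.exp (-(s * t / (N:ℝ) ^ 2)) * w N t ≤ 1 * w N t :=
            mul_le_mul_of_nonneg_right (exp_neg_le_one_of_nonneg hx) (hpos N hN t ht)
        _ = w N t := one_mul _
  -- hlow : a N s ≤ a N 0, eventually
  have hlow : ∀ s, 0 < s → ∀ᶠ N in atTop, a N s ≤ a N 0 := by
    intro s hs
    refine eventually_atTop.mpr ⟨N₀, fun N hN => ?_⟩
    rw [ha0]
    simp only [ha]
    refine mul_le_mul_of_nonneg_left ?_ (by positivity)
    refine setIntegral_mono_on (hIew N s hN hs.le) (hIw N) measurableSet_Ioi fun t ht => ?_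
    have hx : 0 ≤ s * t / (N : ℝ) ^ 2 := by
      have : 0 ≤ t := le_of_lt ht
      positivity
    calc Real.exp (-(s * t / (N:ℝ) ^ 2)) * w N t ≤ 1 * w N t :=
        mul_le_mul_of_nonneg_right (exp_neg_le_one_of_nonneg hx) (hpos N hN t ht)
      _ = w N t := one_mul _
  -- hup : a N 0 ≤ a N s + C s, for N ≥ max N₀ 1
  have hup : ∀ s, 0 < s → ∀ᶠ N in atTop, a N 0 ≤ a N s + C * s := by
    intro s hs
    refine eventually_atTop.mpr ⟨max N₀ 1, fun N hN => ?_⟩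
    have hN0 : N₀ ≤ N := le_trans (le_max_left _ _) hN
    have hN1 : 1 ≤ N := le_trans (le_max_right _ _) hN
    have hNpos : (0:ℝ) < N := by exact_mod_cast hN1
    rw [ha0]
    simp only [ha]
    have hsub : (∫ t in Ioi (0:ℝ), w N t) - (∫ t in Ioi (0:ℝ), Real.exp (-(s * t / (N:ℝ) ^ 2)) * w N t)
        = ∫ t in Ioi (0:ℝ), (1 - Real.exp (-(s * t / (N:ℝ) ^ 2))) * w N t := by
      rw [← integral_sub (hIw N) (hIew N s hN0 hs.le)]
      refine integral_congr_ae (Eventually.of_forall fun t => ?_)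
      ring
    have hI1e : IntegrableOn (fun t => (1 - Real.exp (-(s * t / (N:ℝ) ^ 2))) * w N t) (Ioi 0) := by
      have h' : IntegrableOn (fun t => w N t - Real.exp (-(s * t / (N:ℝ) ^ 2)) * w N t) (Ioi 0) :=
        (hIw N).sub (hIew N s hN0 hs.le)
      exact h'.congr_fun (fun t _ => by ring) measurableSet_Ioi
    have hIst : IntegrableOn (fun t => (s * t / (N:ℝ) ^ 2) * w N t) (Ioi 0) := by
      have h' : IntegrableOn (fun t => (s / (N:ℝ) ^ 2) * (t * w N t)) (Ioi 0) :=
        (hItw N).const_mul (s / (N:ℝ) ^ 2)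
      exact h'.congr_fun (fun t _ => by ring) measurableSet_Ioi
    have hmono : ∫ t in Ioi (0:ℝ), (1 - Real.exp (-(s * t / (N:ℝ) ^ 2))) * w N t
        ≤ ∫ t in Ioi (0:ℝ), (s * t / (N:ℝ) ^ 2) * w N t :=
      setIntegral_mono_on hI1e hIst measurableSet_Ioi fun t ht =>
        mul_le_mul_of_nonneg_right one_sub_exp_neg_le (hpos N hN0 t ht)
    have hscale : ∫ t in Ioi (0:ℝ), (s * t / (N:ℝ) ^ 2) * w N t = (s / (N:ℝ) ^ 2) * ∫ t in Ioi (0:ℝ), t * w N t := by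
      rw [← integral_const_mul]
      refine integral_congr_ae (Eventually.of_forall fun t => ?_)
      ring
    have htrans := (hC N).2.2
    have key : (N:ℝ) * g * ((∫ t in Ioi (0:ℝ), w N t) - ∫ t in Ioi (0:ℝ), Real.exp (-(s * t / (N:ℝ) ^ 2)) * w N t)
        ≤ C * s := by
      rw [hsub]
      calc (N:ℝ) * g * ∫ t in Ioi (0:ℝ), (1 - Real.exp (-(s * t / (N:ℝ) ^ 2))) * w N t
          ≤ (N:ℝ) * g * ∫ t in Ioi (0:ℝ), (s * t / (N:ℝ) ^ 2) * w N t :=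
            mul_le_mul_of_nonneg_left hmono (by positivity)
        _ = (s / (N:ℝ)) * (g * ∫ t in Ioi (0:ℝ), t * w N t) := by
            rw [hscale]; field_simp
        _ ≤ (s / (N:ℝ)) * (C * N) := mul_le_mul_of_nonneg_left htrans (by positivity)
        _ = C * s := by field_simp
    nlinarith [key]
  -- apply the abstract lemma and rewrite a N 0
  have hmain := tendsto_of_abelWindow_of_eventually (a := a) (κ := κ) (C := C) hφ
    (fun s hs => by simpa [ha] using hwin s hs) hlow hup
  refine hmain.congr fun N => ?_
  rw [ha0]

/-- The composition recorded as a `Prop`, PROVED (pointwise positivity is more than enough). -/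
theorem windowComposition : WindowComposition := fun hWP hW hTT =>
  incoherentChannel_of_window' (wakePositivityEventually_of_wakePositivity hWP) hW hTT

/-- The same composition with the hypotheses spelled out (so the audit sees the crux concluded BY NAME). -/
theorem incoherentChannel_of_window (hWP : WakePositivity) (hW : DiffusiveAbelWindow)
    (hTT : WakeTransitTime) : Theses.PhononMeanFreePath.IncoherentChannel :=
  windowComposition hWP hW hTT

/-! ## Card `incoherent-heat-floor`: incoherent heat = fluctuation of the contact response

Exact budget identities behind the card (all at fixed `N`, equilibrium):
heat `𝔭_L + 𝔭_R = 1` (sum rule `(γ/T²)∫(X_N + C_N) = 1`), L²-budget `𝔦_L + 𝔦_R = 1`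
(`‖p_0‖² = 2γT Σ_b ∫‖∂_{p_b}K_t p_0‖²`), Jensen `𝔭^coh_b ≤ 𝔦_b`; hence the identity
`𝔭^inc_L + 𝔭^inc_R = 2γ Σ_b ∫ Var_{μ₀}(∂_{p_b} K_t p_0)`, whose right-hand side has a
short-time floor `> 0` uniformly in `N` for `lam, β > 0`.  The crux is `N γ 𝔭^inc_R → κ`. -/

/-- `∂_{p_b} K_t p_0`: the noise-AVERAGED contact response (never the pathwise tangent flow). -/
def resp (ω₂ lam β γ T : ℝ) (N : ℕ) (b : Fin (N + 1)) (t : ℝ) (z : PhaseSpace (N + 1)) : ℝ :=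
  partialP b (fun x => ∫ y, y.2 0 ∂(ker ω₂ lam β γ T N t x)) z

/-- Its variance over thermal initial data. -/
def respVar (ω₂ lam β γ T : ℝ) (N : ℕ) (b : Fin (N + 1)) (t : ℝ) : ℝ :=
  (∫ z, (resp ω₂ lam β γ T N b t z) ^ 2 ∂(gib ω₂ lam β γ T N))
    - (∫ z, resp ω₂ lam β γ T N b t z ∂(gib ω₂ lam β γ T N)) ^ 2

/-- Coherent RETURN share `𝔭^coh_L = (2γ/T²) ∫₀^∞ ⟨p_0, K_t p_0⟩²`. -/
def pcohL (ω₂ lam β γ T : ℝ) (N : ℕ) : ℝ :=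
  (2 * γ / T ^ 2) * ∫ t in Ioi (0 : ℝ),
    (∫ z, z.2 0 * (∫ y, y.2 0 ∂(ker ω₂ lam β γ T N t z)) ∂(gib ω₂ lam β γ T N)) ^ 2

/-- Coherent TRANSMITTED share `𝔭^coh_R = (2γ/T²) ∫₀^∞ r_N²` (= the route's coherent channel / (γN)). -/
def pcohR (ω₂ lam β γ T : ℝ) (N : ℕ) : ℝ :=
  (2 * γ / T ^ 2) * ∫ t in Ioi (0 : ℝ), (rN ω₂ lam β γ T N t) ^ 2

/-- Incoherent transmitted share `𝔭^inc_R = (γ/T²) ∫₀^∞ wake_N`; the crux reads `N γ 𝔭^inc_R → κ`. -/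
def pincR (ω₂ lam β γ T : ℝ) (N : ℕ) : ℝ :=
  (γ / T ^ 2) * ∫ t in Ioi (0 : ℝ), wake ω₂ lam β γ T N t

/-- FIRST LEMMA of `incoherent-heat-floor` (support, theorem-grade at fixed `N`): the total
incoherent heat equals the time-integrated thermal variance of the noise-averaged contact response. -/
def IncoherentHeatIdentity : Prop :=
  ∀ ω₂ lam β γ : ℝ, 0 < ω₂ → 0 < lam → 0 < β → 0 < γ → ∀ T : ℝ, 0 < T → ∀ N : ℕ, 1 ≤ N →
    1 - pcohL ω₂ lam β γ T N - pcohR ω₂ lam β γ T N =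
      2 * γ * ((∫ t in Ioi (0 : ℝ), respVar ω₂ lam β γ T N 0 t)
        + ∫ t in Ioi (0 : ℝ), respVar ω₂ lam β γ T N (Fin.last N) t)

/-- The N-UNIFORM FLOOR: a fixed fraction of a contact kick's energy thermalises (lam, β > 0). -/
def IncoherentHeatFloor : Prop :=
  ∀ ω₂ lam β γ : ℝ, 0 < ω₂ → 0 < lam → 0 < β → 0 < γ → ∀ T : ℝ, 0 < T → ∃ c : ℝ, 0 < c ∧ ∀ N : ℕ, 1 ≤ N →
    c ≤ 1 - pcohL ω₂ lam β γ T N - pcohR ω₂ lam β γ T N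

/-- The crux in share form (exact rewriting): `N · γ · 𝔭^inc_R(N) → κ`. PROVED equivalent. -/
theorem incoherentChannel_iff_share :
    Theses.PhononMeanFreePath.IncoherentChannel ↔
      ∀ ω₂ lam β γ : ℝ, 0 < ω₂ → 0 < lam → 0 < β → 0 < γ → ∀ T : ℝ, 0 < T → ∃ κ : ℝ, 0 < κ ∧
        Tendsto (fun N : ℕ => (N : ℝ) * γ * pincR ω₂ lam β γ T N) atTop (𝓝 κ) := by
  rw [incoherentChannel_iff_wake]
  have key : ∀ (γ T : ℝ) (N : ℕ) (I : ℝ), (N : ℝ) * (γ ^ 2 / T ^ 2) * I = (N : ℝ) * γ * ((γ / T ^ 2) * I) := by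
    intro γ T N I; ring
  simp only [pincR, ← key]

end Summit.AtomisticToContinuum.FouriersLaw.Cruxes.IncoherentChannel.Ideator3
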